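import Summits.AtomisticToContinuum.FouriersLaw.Theorems.BondHeatUncertaintySubdiffusiveBondHeatBathBondReductionVariance
import Summits.AtomisticToContinuum.FouriersLaw.Theorems.BondHeatUncertaintySubdiffusiveBondHeatDeficitCesaroLinear

/-!
# Spectral positivity of the boundary kernel: `∫₀^∞ cos(ωu) K_N(u) du ≥ 0` for every frequency, `N`-uniformly

Crux `stmt-AtomisticToContinuum-9120` (`BondHeatUncertainty.SubdiffusiveBondHeat`, (S)), line `bath-bond-deficit-integral`
(lead c5).  Notation VERBATIM the `let K / E` of route `BoundaryEscapeDeficit`: `K_N(u) = ∫ (p₀² − T)·P_u(p₀² − T) dμ_T^N`,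
`E_N = 1 − (γ/T²)∫_{(0,∞)} K_N`.

* `pinnedChain_integral_weightedTimeIntegral_sq_of_invariant` — **weighted second moments along the stationary flow**: for an
  invariant initial law `μ`, `f ∈ L²(μ)`, a measurable weight `|c| ≤ 1` and `t ≥ 0`,
  `E_{μ⊗W}[(∫₀ᵗ c(s) f(z_s) ds)²] = ∫∫_{(0,t]²} c(u)c(v) K_f(|v − u|) du dv` with `K_f(r) = ∫ f·(P_r f) dμ`;
* `pinnedChain_integral_cos_sq_add_sin_sq_of_invariant` — with `c = cos(ω·)` and `c = sin(ω·)`: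
  `E[(∫₀ᵗ cos(ωs) f(z_s))²] + E[(∫₀ᵗ sin(ωs) f(z_s))²] = 2∫₀ᵗ (t − r) cos(ωr) K_f(r) dr`, hence
  `pinnedChain_lagIntegral_cos_mul_nonneg`: `0 ≤ ∫₀ᵗ (t − r) cos(ωr) K_f(r) dr` (positive-definiteness of a stationary
  autocorrelation, Fejér form);
* `pinnedChain_lagIntegral_cos_kinCorr_nonneg` — the boundary kinetic observable `f = p₀² − T` under the Gibbs measure:
  `0 ≤ ∫₀ᵗ (t − r) cos(ωr) K_N(r) dr` for all `t ≥ 0`, all `ω`, all `N ≥ 1`.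

The Fejér limit `t → ∞` (`∫₀^∞ cos(ωu)K_N(u) du ≥ 0`, i.e. the boundary noise spectrum is nonnegative, and the Warburg dip
`(γ/T²)∫₀^∞(1 − cos ωu)K_N ≤ 1 − E_N ≤ 1` uniformly in `N`) is taken in the sequel file.  Fixed-`N` technology used
`N`-uniformly; nothing here closes the item.
-/

noncomputable section

open MeasureTheory ProbabilityTheory Filter Topology Set intervalIntegral
open scoped NNReal ENNReal
open Literature.MathematicalPhysics.KineticTheory.HeatConduction Literature.Probability.Process

namespace Summit.AtomisticToContinuum.FouriersLaw.Theorems.SubdiffusiveBondHeat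

open OscillatorChain

/-! ### Weighted second moments of time integrals along the stationary flow -/

section Weighted

variable {ω₂ lam β γ : ℝ} (hω : 0 < ω₂) (hl : 0 ≤ lam) (hβ : 0 ≤ β) (hγ : 0 ≤ γ) (N : ℕ) (T_L T_R : ℝ)
include hω hl hβ hγ

/-- **Weighted second moments along the stationary flow.**  For an initial law `μ` invariant for the constructed kernels,
`f` measurable with `f² ∈ L¹(μ)`, measurable weights `c, d` with `|c|, |d| ≤ 1` and `t ≥ 0`:
`E_{μ⊗W}[(∫₀ᵗ c(s) f(z_s) ds)(∫₀ᵗ d(s) f(z_s) ds)] = ∫∫_{(0,t]²} c(u) d(v) K_f(|v − u|) du dv`, `K_f(r) = ∫ f·(P_r f) dμ`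
(two-time law + invariance: `E[f(z_u) f(z_v)] = K_f(|v − u|)`). [folklore] -/
theorem pinnedChain_integral_weightedTimeIntegral_mul_of_invariant (μ : Measure (PhaseSpace N)) [SFinite μ]
    (hinv : ∀ s : ℝ≥0, μ.bind ((pinnedChain ω₂ lam β γ).transitionKernel N T_L T_R s) = μ)
    {f : PhaseSpace N → ℝ} (hf : Measurable f) (hf2 : Integrable (fun y => f y ^ 2) μ)
    {c d : ℝ → ℝ} (hc : Measurable c) (hd : Measurable d) (hcb : ∀ s, |c s| ≤ 1) (hdb : ∀ s, |d s| ≤ 1)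
    {t : ℝ} (ht : 0 ≤ t) :
    ∫ p, (∫ s in (0 : ℝ)..t, c s * f ((pinnedChain ω₂ lam β γ).solMap N T_L T_R s p.1 (pairPath p.2))) *
        (∫ s in (0 : ℝ)..t, d s * f ((pinnedChain ω₂ lam β γ).solMap N T_L T_R s p.1 (pairPath p.2)))
        ∂(μ.prod wienerPair) =
      ∫ z in Ioc 0 t ×ˢ Ioc 0 t, c z.1 * d z.2 *
        (∫ y, f y * (∫ y', f y' ∂((pinnedChain ω₂ lam β γ).transitionKernel N T_L T_R (|z.2 - z.1|).toNNReal y)) ∂μ)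
        ∂(volume.prod volume) := by
  -- the finite measure `L = Lebesgue ↾ (0, t]`
  haveI hLfin : IsFiniteMeasure ((volume : Measure ℝ).restrict (Ioc 0 t)) := by
    refine ⟨?_⟩
    rw [Measure.restrict_apply_univ]
    exact measure_Ioc_lt_top
  have hZ := pinnedChain_measurable_solMap_process hω hl hβ hγ N T_L T_R
  -- kernel form of `E[f(z_u) f(z_v)]` on the square
  have hpair : ∀ u v : ℝ, 0 ≤ u → 0 ≤ v →
      ∫ p, f ((pinnedChain ω₂ lam β γ).solMap N T_L T_R u p.1 (pairPath p.2)) *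
          f ((pinnedChain ω₂ lam β γ).solMap N T_L T_R v p.1 (pairPath p.2)) ∂(μ.prod wienerPair) =
        ∫ y, f y * (∫ y', f y' ∂((pinnedChain ω₂ lam β γ).transitionKernel N T_L T_R (|v - u|).toNNReal y)) ∂μ := by
    intro u v hu hv
    rcases le_total u v with huv | hvu
    · rw [abs_of_nonneg (sub_nonneg.2 huv)]
      exact pinnedChain_integral_mul_solMap_of_invariant hω hl hβ hγ N T_L T_R μ hinv hf hf hf2 hf2 hu huv
    · rw [abs_of_nonpos (sub_nonpos.2 hvu), neg_sub]
      have heq : ∫ p, f ((pinnedChain ω₂ lam β γ).solMap N T_L T_R u p.1 (pairPath p.2)) *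
          f ((pinnedChain ω₂ lam β γ).solMap N T_L T_R v p.1 (pairPath p.2)) ∂(μ.prod wienerPair) =
          ∫ p, f ((pinnedChain ω₂ lam β γ).solMap N T_L T_R v p.1 (pairPath p.2)) *
            f ((pinnedChain ω₂ lam β γ).solMap N T_L T_R u p.1 (pairPath p.2)) ∂(μ.prod wienerPair) :=
        integral_congr_ae (Eventually.of_forall fun p => mul_comm _ _)
      rw [heq]
      exact pinnedChain_integral_mul_solMap_of_invariant hω hl hβ hγ N T_L T_R μ hinv hf hf hf2 hf2 hv hvu
  -- Step 1: the product of weighted time integrals as an integral over the square, path by path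
  have hpt : ∀ p : PhaseSpace N × WienerPair,
      (∫ s in (0 : ℝ)..t, c s * f ((pinnedChain ω₂ lam β γ).solMap N T_L T_R s p.1 (pairPath p.2))) *
        (∫ s in (0 : ℝ)..t, d s * f ((pinnedChain ω₂ lam β γ).solMap N T_L T_R s p.1 (pairPath p.2))) =
      ∫ z, (c z.1 * f ((pinnedChain ω₂ lam β γ).solMap N T_L T_R z.1 p.1 (pairPath p.2))) *
          (d z.2 * f ((pinnedChain ω₂ lam β γ).solMap N T_L T_R z.2 p.1 (pairPath p.2)))
        ∂(((volume : Measure ℝ).restrict (Ioc 0 t)).prod ((volume : Measure ℝ).restrict (Ioc 0 t))) := by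
    intro p
    rw [integral_of_le ht, integral_of_le ht]
    exact (integral_prod_mul (μ := (volume : Measure ℝ).restrict (Ioc 0 t))
      (ν := (volume : Measure ℝ).restrict (Ioc 0 t))
      (fun s => c s * f ((pinnedChain ω₂ lam β γ).solMap N T_L T_R s p.1 (pairPath p.2)))
      (fun s => d s * f ((pinnedChain ω₂ lam β γ).solMap N T_L T_R s p.1 (pairPath p.2)))).symm
  rw [integral_congr_ae (Eventually.of_forall hpt)]
  -- Step 2: Fubini between `Ω` and the square (the weighted integrand is dominated by the unweighted one)
  have hGi := pinnedChain_integrable_uncurry_timeSquare_of_invariant hω hl hβ hγ N T_L T_R μ hinv hf hf hf2 hf2 t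
  have hWm : Measurable (Function.uncurry fun (p : PhaseSpace N × WienerPair) (z : ℝ × ℝ) =>
      (c z.1 * f ((pinnedChain ω₂ lam β γ).solMap N T_L T_R z.1 p.1 (pairPath p.2))) *
        (d z.2 * f ((pinnedChain ω₂ lam β γ).solMap N T_L T_R z.2 p.1 (pairPath p.2)))) := by
    have h1 : Measurable fun w : (PhaseSpace N × WienerPair) × (ℝ × ℝ) => (w.2.1, w.1) :=
      (measurable_fst.comp measurable_snd).prodMk measurable_fst
    have h2 : Measurable fun w : (PhaseSpace N × WienerPair) × (ℝ × ℝ) => (w.2.2, w.1) :=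
      (measurable_snd.comp measurable_snd).prodMk measurable_fst
    have hA := hf.comp (hZ.comp h1)
    have hB := hf.comp (hZ.comp h2)
    have hc' : Measurable fun w : (PhaseSpace N × WienerPair) × (ℝ × ℝ) => c w.2.1 :=
      hc.comp (measurable_fst.comp measurable_snd)
    have hd' : Measurable fun w : (PhaseSpace N × WienerPair) × (ℝ × ℝ) => d w.2.2 :=
      hd.comp (measurable_snd.comp measurable_snd)
    exact (hc'.mul hA).mul (hd'.mul hB)
  have hWi : Integrable (Function.uncurry fun (p : PhaseSpace N × WienerPair) (z : ℝ × ℝ) =>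
      (c z.1 * f ((pinnedChain ω₂ lam β γ).solMap N T_L T_R z.1 p.1 (pairPath p.2))) *
        (d z.2 * f ((pinnedChain ω₂ lam β γ).solMap N T_L T_R z.2 p.1 (pairPath p.2))))
      ((μ.prod wienerPair).prod
        (((volume : Measure ℝ).restrict (Ioc 0 t)).prod ((volume : Measure ℝ).restrict (Ioc 0 t)))) := by
    refine hGi.mono hWm.aestronglyMeasurable (Eventually.of_forall fun w => ?_)
    simp only [Function.uncurry, Real.norm_eq_abs, abs_mul]
    have h1 := hcb w.2.1
    have h2 := hdb w.2.2
    have hA := abs_nonneg (f ((pinnedChain ω₂ lam β γ).solMap N T_L T_R w.2.1 w.1.1 (pairPath w.1.2)))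
    have hB := abs_nonneg (f ((pinnedChain ω₂ lam β γ).solMap N T_L T_R w.2.2 w.1.1 (pairPath w.1.2)))
    calc |c w.2.1| * |f ((pinnedChain ω₂ lam β γ).solMap N T_L T_R w.2.1 w.1.1 (pairPath w.1.2))| *
          (|d w.2.2| * |f ((pinnedChain ω₂ lam β γ).solMap N T_L T_R w.2.2 w.1.1 (pairPath w.1.2))|)
        ≤ 1 * |f ((pinnedChain ω₂ lam β γ).solMap N T_L T_R w.2.1 w.1.1 (pairPath w.1.2))| *
          (1 * |f ((pinnedChain ω₂ lam β γ).solMap N T_L T_R w.2.2 w.1.1 (pairPath w.1.2))|) := by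
          gcongr
      _ = _ := by ring
  rw [integral_integral_swap hWi]
  -- Step 3: the inner integral on the square is the weighted lag function
  have hsq : ∀ z ∈ Ioc (0 : ℝ) t ×ˢ Ioc (0 : ℝ) t,
      ∫ p, (c z.1 * f ((pinnedChain ω₂ lam β γ).solMap N T_L T_R z.1 p.1 (pairPath p.2))) *
          (d z.2 * f ((pinnedChain ω₂ lam β γ).solMap N T_L T_R z.2 p.1 (pairPath p.2))) ∂(μ.prod wienerPair) =
        c z.1 * d z.2 *
          (∫ y, f y * (∫ y', f y' ∂((pinnedChain ω₂ lam β γ).transitionKernel N T_L T_R (|z.2 - z.1|).toNNReal y)) ∂μ) := by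
    intro z hz
    obtain ⟨⟨hz1, -⟩, ⟨hz2, -⟩⟩ := hz
    rw [← hpair z.1 z.2 hz1.le hz2.le, ← MeasureTheory.integral_const_mul]
    refine integral_congr_ae (Eventually.of_forall fun p => ?_)
    ring
  rw [Measure.prod_restrict, setIntegral_congr_fun (measurableSet_Ioc.prod measurableSet_Ioc) hsq]

/-- **`cos² + sin²` second moments along the stationary flow**: for an invariant initial law `μ`, `f ∈ L²(μ)`, a frequency
`ω` and `t ≥ 0`,
`E[(∫₀ᵗ cos(ωs) f(z_s) ds)²] + E[(∫₀ᵗ sin(ωs) f(z_s) ds)²] = 2∫₀ᵗ (t − r) cos(ωr) K_f(r) dr`, `K_f(r) = ∫ f·(P_r f) dμ`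
(`cos(ωu)cos(ωv) + sin(ωu)sin(ωv) = cos(ω(v − u))` and the square-to-lag reduction). [folklore] -/
theorem pinnedChain_integral_cos_sq_add_sin_sq_of_invariant (μ : Measure (PhaseSpace N)) [SFinite μ]
    (hinv : ∀ s : ℝ≥0, μ.bind ((pinnedChain ω₂ lam β γ).transitionKernel N T_L T_R s) = μ)
    {f : PhaseSpace N → ℝ} (hf : Measurable f) (hf2 : Integrable (fun y => f y ^ 2) μ)
    (hKm : Measurable fun r : ℝ =>
      ∫ y, f y * (∫ y', f y' ∂((pinnedChain ω₂ lam β γ).transitionKernel N T_L T_R r.toNNReal y)) ∂μ)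
    (ω : ℝ) {t : ℝ} (ht : 0 ≤ t) :
    (∫ p, (∫ s in (0 : ℝ)..t, Real.cos (ω * s) *
        f ((pinnedChain ω₂ lam β γ).solMap N T_L T_R s p.1 (pairPath p.2))) ^ 2 ∂(μ.prod wienerPair)) +
      (∫ p, (∫ s in (0 : ℝ)..t, Real.sin (ω * s) *
        f ((pinnedChain ω₂ lam β γ).solMap N T_L T_R s p.1 (pairPath p.2))) ^ 2 ∂(μ.prod wienerPair)) =
      2 * ∫ r in (0 : ℝ)..t, (t - r) * (Real.cos (ω * r) *
        ∫ y, f y * (∫ y', f y' ∂((pinnedChain ω₂ lam β γ).transitionKernel N T_L T_R r.toNNReal y)) ∂μ) := by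
  haveI hLfin : IsFiniteMeasure ((volume : Measure ℝ).restrict (Ioc 0 t)) := by
    refine ⟨?_⟩
    rw [Measure.restrict_apply_univ]
    exact measure_Ioc_lt_top
  set K : ℝ → ℝ := fun r =>
    ∫ y, f y * (∫ y', f y' ∂((pinnedChain ω₂ lam β γ).transitionKernel N T_L T_R r.toNNReal y)) ∂μ with hK
  have hcm : Measurable fun s : ℝ => Real.cos (ω * s) := by fun_prop
  have hsm : Measurable fun s : ℝ => Real.sin (ω * s) := by fun_prop
  have hcb : ∀ s : ℝ, |Real.cos (ω * s)| ≤ 1 := fun s => Real.abs_cos_le_one _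
  have hsb : ∀ s : ℝ, |Real.sin (ω * s)| ≤ 1 := fun s => Real.abs_sin_le_one _
  have hcos := pinnedChain_integral_weightedTimeIntegral_mul_of_invariant hω hl hβ hγ N T_L T_R μ hinv hf hf2
    hcm hcm hcb hcb ht
  have hsin := pinnedChain_integral_weightedTimeIntegral_mul_of_invariant hω hl hβ hγ N T_L T_R μ hinv hf hf2
    hsm hsm hsb hsb ht
  simp only [sq]
  rw [hcos, hsin]
  -- `K` is bounded by `∫ f²`
  have hF2 := fun r => pinnedChain_integrable_sq_solMap_of_invariant hω hl hβ hγ N T_L T_R μ hinv hf2 r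
  have hKb : ∀ r : ℝ, |K r| ≤ (∫ y, f y ^ 2 ∂μ) + ∫ y, f y ^ 2 ∂μ := by
    intro r
    have hr : 0 ≤ max r 0 := le_max_right _ _
    have h1 := pinnedChain_integral_mul_solMap_of_invariant hω hl hβ hγ N T_L T_R μ hinv hf hf hf2 hf2 le_rfl hr
    rw [sub_zero] at h1
    have hK' : K r = K (max r 0) := by
      simp only [hK]
      congr 1
      rcases le_total r 0 with h | h
      · rw [max_eq_right h, Real.toNNReal_of_nonpos h, Real.toNNReal_zero]
      · rw [max_eq_left h]
    rw [hK']
    simp only [hK]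
    rw [← h1]
    have hint : Integrable (fun p : PhaseSpace N × WienerPair =>
        f ((pinnedChain ω₂ lam β γ).solMap N T_L T_R 0 p.1 (pairPath p.2)) *
          f ((pinnedChain ω₂ lam β γ).solMap N T_L T_R (max r 0) p.1 (pairPath p.2))) (μ.prod wienerPair) := by
      have hm : Measurable (fun p : PhaseSpace N × WienerPair =>
          f ((pinnedChain ω₂ lam β γ).solMap N T_L T_R 0 p.1 (pairPath p.2)) *
            f ((pinnedChain ω₂ lam β γ).solMap N T_L T_R (max r 0) p.1 (pairPath p.2))) :=
        (hf.comp (pinnedChain_measurable_solMap_pairPath hω hl hβ hγ N T_L T_R 0)).mul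
          (hf.comp (pinnedChain_measurable_solMap_pairPath hω hl hβ hγ N T_L T_R (max r 0)))
      refine ((hF2 0).1.add (hF2 (max r 0)).1).mono' hm.aestronglyMeasurable (Eventually.of_forall fun p => ?_)
      simpa [Real.norm_eq_abs] using abs_mul_le_sq_add_sq _ _
    have hgoal : |∫ p, f ((pinnedChain ω₂ lam β γ).solMap N T_L T_R 0 p.1 (pairPath p.2)) *
        f ((pinnedChain ω₂ lam β γ).solMap N T_L T_R (max r 0) p.1 (pairPath p.2)) ∂(μ.prod wienerPair)| ≤
        (∫ p, f ((pinnedChain ω₂ lam β γ).solMap N T_L T_R 0 p.1 (pairPath p.2)) ^ 2 ∂(μ.prod wienerPair)) +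
          ∫ p, f ((pinnedChain ω₂ lam β γ).solMap N T_L T_R (max r 0) p.1 (pairPath p.2)) ^ 2
            ∂(μ.prod wienerPair) := by
      rw [← integral_add (hF2 0).1 (hF2 (max r 0)).1, ← Real.norm_eq_abs]
      refine (MeasureTheory.norm_integral_le_integral_norm _).trans
        (integral_mono hint.norm ((hF2 0).1.add (hF2 (max r 0)).1) ?_)
      intro p
      simpa [Real.norm_eq_abs] using abs_mul_le_sq_add_sq _ _
    rw [(hF2 0).2, (hF2 (max r 0)).2] at hgoal
    exact hgoal
  -- the two square integrands are integrable (bounded, measurable, finite measure)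
  set B : ℝ := (∫ y, f y ^ 2 ∂μ) + ∫ y, f y ^ 2 ∂μ with hB
  have hKzm : Measurable fun z : ℝ × ℝ => K (|z.2 - z.1|) :=
    hKm.comp ((measurable_snd.sub measurable_fst).abs)
  have hIc : Integrable (fun z : ℝ × ℝ => Real.cos (ω * z.1) * Real.cos (ω * z.2) * K (|z.2 - z.1|))
      (((volume : Measure ℝ).restrict (Ioc 0 t)).prod ((volume : Measure ℝ).restrict (Ioc 0 t))) := by
    have hm : Measurable fun z : ℝ × ℝ => Real.cos (ω * z.1) * Real.cos (ω * z.2) * K (|z.2 - z.1|) :=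
      ((hcm.comp measurable_fst).mul (hcm.comp measurable_snd)).mul hKzm
    refine (integrable_const B).mono' hm.aestronglyMeasurable (Eventually.of_forall fun z => ?_)
    rw [Real.norm_eq_abs, abs_mul, abs_mul]
    calc |Real.cos (ω * z.1)| * |Real.cos (ω * z.2)| * |K (|z.2 - z.1|)| ≤ 1 * 1 * B := by
          gcongr
          · exact hcb z.1
          · exact hcb z.2
          · exact hKb _
      _ = B := by ring
  have hIs : Integrable (fun z : ℝ × ℝ => Real.sin (ω * z.1) * Real.sin (ω * z.2) * K (|z.2 - z.1|))
      (((volume : Measure ℝ).restrict (Ioc 0 t)).prod ((volume : Measure ℝ).restrict (Ioc 0 t))) := by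
    have hm : Measurable fun z : ℝ × ℝ => Real.sin (ω * z.1) * Real.sin (ω * z.2) * K (|z.2 - z.1|) :=
      ((hsm.comp measurable_fst).mul (hsm.comp measurable_snd)).mul hKzm
    refine (integrable_const B).mono' hm.aestronglyMeasurable (Eventually.of_forall fun z => ?_)
    rw [Real.norm_eq_abs, abs_mul, abs_mul]
    calc |Real.sin (ω * z.1)| * |Real.sin (ω * z.2)| * |K (|z.2 - z.1|)| ≤ 1 * 1 * B := by
          gcongr
          · exact hsb z.1
          · exact hsb z.2
          · exact hKb _
      _ = B := by ring
  rw [Measure.prod_restrict] at hIc hIs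
  rw [← integral_add hIc hIs]
  -- combine: `cos cos + sin sin = cos (ω (z.2 - z.1))`, an even function of the lag
  have hlag : ∀ z ∈ Ioc (0 : ℝ) t ×ˢ Ioc (0 : ℝ) t,
      Real.cos (ω * z.1) * Real.cos (ω * z.2) * K (|z.2 - z.1|) +
          Real.sin (ω * z.1) * Real.sin (ω * z.2) * K (|z.2 - z.1|) =
        if z.1 < z.2 then Real.cos (ω * (z.2 - z.1)) * K (z.2 - z.1)
          else Real.cos (ω * (z.1 - z.2)) * K (z.1 - z.2) := by
    intro z _
    have hcs : Real.cos (ω * z.1) * Real.cos (ω * z.2) + Real.sin (ω * z.1) * Real.sin (ω * z.2) =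
        Real.cos (ω * (z.2 - z.1)) := by
      rw [mul_sub, Real.cos_sub]; ring
    by_cases hlt : z.1 < z.2
    · rw [if_pos hlt, abs_of_nonneg (sub_nonneg.2 hlt.le), ← add_mul, hcs]
    · rw [if_neg hlt, abs_of_nonpos (sub_nonpos.2 (not_lt.1 hlt)), neg_sub, ← add_mul, hcs]
      congr 1
      rw [← Real.cos_neg]
      congr 1
      ring
  rw [setIntegral_congr_fun (measurableSet_Ioc.prod measurableSet_Ioc) hlag]
  -- square-to-lag reduction
  have ham : Measurable fun r : ℝ => Real.cos (ω * r) * K r := hcm.mul hKm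
  have haB : ∀ r : ℝ, |Real.cos (ω * r) * K r| ≤ B := by
    intro r
    rw [abs_mul]
    calc |Real.cos (ω * r)| * |K r| ≤ 1 * B := by
          gcongr
          · exact hcb r
          · exact hKb r
      _ = B := by ring
  rw [setIntegral_square_lag_eq ham ham haB haB ht, ← intervalIntegral.integral_const_mul]
  refine intervalIntegral.integral_congr fun r _ => ?_
  ring

/-- **Positive-definiteness of a stationary autocorrelation, Fejér form**: under the hypotheses of
`pinnedChain_integral_cos_sq_add_sin_sq_of_invariant`, `0 ≤ ∫₀ᵗ (t − r) cos(ωr) K_f(r) dr` for every `ω` and `t ≥ 0`.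
[folklore] -/
theorem pinnedChain_lagIntegral_cos_mul_nonneg (μ : Measure (PhaseSpace N)) [SFinite μ]
    (hinv : ∀ s : ℝ≥0, μ.bind ((pinnedChain ω₂ lam β γ).transitionKernel N T_L T_R s) = μ)
    {f : PhaseSpace N → ℝ} (hf : Measurable f) (hf2 : Integrable (fun y => f y ^ 2) μ)
    (hKm : Measurable fun r : ℝ =>
      ∫ y, f y * (∫ y', f y' ∂((pinnedChain ω₂ lam β γ).transitionKernel N T_L T_R r.toNNReal y)) ∂μ)
    (ω : ℝ) {t : ℝ} (ht : 0 ≤ t) :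
    0 ≤ ∫ r in (0 : ℝ)..t, (t - r) * (Real.cos (ω * r) *
        ∫ y, f y * (∫ y', f y' ∂((pinnedChain ω₂ lam β γ).transitionKernel N T_L T_R r.toNNReal y)) ∂μ) := by
  have h := pinnedChain_integral_cos_sq_add_sin_sq_of_invariant hω hl hβ hγ N T_L T_R μ hinv hf hf2 hKm ω ht
  have h1 : 0 ≤ ∫ p, (∫ s in (0 : ℝ)..t, Real.cos (ω * s) *
      f ((pinnedChain ω₂ lam β γ).solMap N T_L T_R s p.1 (pairPath p.2))) ^ 2 ∂(μ.prod wienerPair) :=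
    integral_nonneg fun _ => sq_nonneg _
  have h2 : 0 ≤ ∫ p, (∫ s in (0 : ℝ)..t, Real.sin (ω * s) *
      f ((pinnedChain ω₂ lam β γ).solMap N T_L T_R s p.1 (pairPath p.2))) ^ 2 ∂(μ.prod wienerPair) :=
    integral_nonneg fun _ => sq_nonneg _
  linarith

end Weighted

/-! ### The boundary kinetic observable under the Gibbs measure -/

section FixedN

variable {ω₂ lam β γ T : ℝ} (hω : 0 < ω₂) (hl : 0 < lam) (hβ : 0 < β) (hγ : 0 < γ) (hT : 0 < T) {N : ℕ}
  (hN : 0 < N)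
include hω hl hβ hγ hT hN

/-- **Fejér positivity of the boundary kernel at every frequency**: `0 ≤ ∫₀ᵗ (t − r) cos(ωr) K_N(r) dr` for all `t ≥ 0`
and all `ω`, `K_N(u) = ∫ (p₀² − T)·P_u(p₀² − T) dμ_T^N` — it is half of
`E[(∫₀ᵗ cos(ωs)(p₀² − T)(z_s) ds)²] + E[(∫₀ᵗ sin(ωs)(p₀² − T)(z_s) ds)²]` along the stationary constructed flow
(Gibbs invariance = clause (a) of `BoundaryKernelBasics`).  At `ω = 0` this is
`pinnedChain_primitive_kinKernel_integral_nonneg`. [folklore] -/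
theorem pinnedChain_lagIntegral_cos_kinCorr_nonneg (ω : ℝ) {t : ℝ} (ht : 0 ≤ t) :
    0 ≤ ∫ r in (0 : ℝ)..t, (t - r) * (Real.cos (ω * r) *
        ∫ z, ((z.2 ⟨0, hN⟩) ^ 2 - T) *
            (∫ y, ((y.2 ⟨0, hN⟩) ^ 2 - T) ∂((pinnedChain ω₂ lam β γ).transitionKernel N T T r.toNNReal z))
          ∂((pinnedChain ω₂ lam β γ).gibbsMeasure N T)) := by
  have hinv : ∀ s : ℝ≥0, ((pinnedChain ω₂ lam β γ).gibbsMeasure N T).bind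
      ((pinnedChain ω₂ lam β γ).transitionKernel N T T s) = (pinnedChain ω₂ lam β γ).gibbsMeasure N T := fun s =>
    pinnedChain_gibbsMeasure_bind_transitionKernel hω hl.le hβ.le hγ.le hN hT s
  haveI : IsProbabilityMeasure ((pinnedChain ω₂ lam β γ).gibbsMeasure N T) :=
    pinnedChain_isProbabilityMeasure_gibbsMeasure hω hl.le hβ.le γ N hT
  have hKm : Measurable (fun y : PhaseSpace N => (y.2 ⟨0, hN⟩) ^ 2 - T) := by fun_prop
  have hK2 := pinnedChain_integrable_sq_kinObs₀ (γ := γ) hω hl hβ hT hN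
  obtain ⟨-, hKc, -, -, -⟩ := boundaryKernelBasics_proof ω₂ lam β γ hω hl hβ hγ T hT N hN
  simp only [dif_pos hN] at hKc
  exact pinnedChain_lagIntegral_cos_mul_nonneg hω hl.le hβ.le hγ.le N T T ((pinnedChain ω₂ lam β γ).gibbsMeasure N T)
    hinv hKm hK2 hKc.measurable ω ht

end FixedN

/-- **Fejér positivity of the boundary kernel, `dite` spelling** (registered sub-goal; every `N : ℕ` — for `N = 0` the kernel
is the junk `0`): for all parameters `> 0`, `T > 0`, `N`, `ω` and `t ≥ 0`, `0 ≤ ∫₀ᵗ (t − r) cos(ωr) K_N(r) dr`. [folklore] -/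
theorem lagIntegral_cos_kinCorr_nonneg :
    ∀ ω₂ lam β γ : ℝ, 0 < ω₂ → 0 < lam → 0 < β → 0 < γ → ∀ T : ℝ, 0 < T → ∀ (N : ℕ) (ω t : ℝ), 0 ≤ t → 0 ≤ ∫ r in (0 : ℝ)..t, (t - r) * (Real.cos (ω * r) * (if h : 0 < N then ∫ z, ((z.2 ⟨0, h⟩) ^ 2 - T) * (∫ y, ((y.2 ⟨0, h⟩) ^ 2 - T) ∂((Literature.MathematicalPhysics.KineticTheory.HeatConduction.pinnedChain ω₂ lam β γ).transitionKernel N T T r.toNNReal z)) ∂((Literature.MathematicalPhysics.KineticTheory.HeatConduction.pinnedChain ω₂ lam β γ).gibbsMeasure N T) else 0)) := by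
  intro ω₂ lam β γ hω hl hβ hγ T hT N ω t ht
  rcases Nat.eq_zero_or_pos N with rfl | hN
  · simp
  · simp only [dif_pos hN]
    exact pinnedChain_lagIntegral_cos_kinCorr_nonneg hω hl hβ hγ hT hN ω ht

end Summit.AtomisticToContinuum.FouriersLaw.Theorems.SubdiffusiveBondHeat

end
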